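import Literature.MathematicalPhysics.QuantumFieldTheory.Balaban1983to89.B8SockSP5UniformThresholdsSrcGammaPrime
import Literature.MathematicalPhysics.QuantumFieldTheory.Balaban1983to89.B8Thm4ZdGF3PMapGammaPrime
import Literature.MathematicalPhysics.QuantumFieldTheory.Balaban1983to89.B8Prop3PrintedZdGF3PGamma
import Literature.MathematicalPhysics.QuantumFieldTheory.Balaban1983to89.B8TowerBondsPrinted
import Summits.QuantumFields.YangMills.Theorems.BalabanUVNodesN16H5OfPSlot
import HarnessLib

/-!
# Route «BalabanUVNodes», cluster K4 «SpineRates» — node N16 = NE3: `h5` FROM [Balaban1985BackgroundPropagators]'s FOUR LETTERS AT THE PINNED ALL-TORUS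
# MEMBERS ONLY, in the γ′ (one-end-point, SOURCED) currency of node N05's knit of record — stage-free, β-generic (trigger (t-γ)'s N16 face)

Cell `pub-ymgap`, width seat `pub-ymgap-dag-n16-w2` (g3, harness re-seat of g2; director-ym №197 ∕ HUMAN RULING D-0149), node N16.
`--kind proof --supports stmt-QuantumFields-20544 --as helper` (K3⁷ `SpineGivenEndpointR13SepCoPH`).  `bears_on: R4∕N16 · edge N05 → N16`.

WHY.  Node N16 reads node N05 ONLY through module 37ᴴ's per-family hypothesis `h5` (`…N16OfEdgesAllTorusAtRecord13CoPH` :160 = the evidence file's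
`N16DischargeTest.stub_h5 β F`): side letters, a window, and node N05's two conjuncts `B8.Thm4Body c₁ B₁'` ∕ `B8.Prop3Body cP 4 F.L C₂ inp B₀β` on n05-a's family
`zdGF3 (M_N ℂ) F.L β len` over the PINNED all-torus members `{i : ZdIdx 4 F.L // Ω ≡ univ ∧ Λs m j = {j = m} ∧ Λb m j = {j = m} ∧ η = (F.L⁻¹)^k}`.  Node N05's knit
of record has moved to the γ′ (one-end-point, sourced) socket family: dag-n05-d's D9b `…N05SubBPKnitGammaPrime` (p596490) ∕ D9d `…PrintCube` (p599197) conclude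
the whole P-slot from [Balaban1985BackgroundPropagators]'s LETTERS at the `Ω₀ = ℤᵈ` law members (`SLet` = `SockLettersRD`, `SLetUB` = the guarded uniqueness
letters, `SH59src` = Thm 3.3 with source in (1.146)'s frame, `SB9P` = the sourceless b9 socket of Prop. 3's frame), Theorem 8's free constant `B₈`, and the
displayed Prop. 5 ∕ 6 ∕ 7 ∕ Thm 8-sourced lines.  `h5` reads only the `t4P` ∕ `p3P` conjuncts, and only at the pinned members (all of which are law members,
dag-n16-c `idxB8LawsB_allTorusPinned`).  THIS FILE is the corresponding N16 face: `h5` from the four letters demanded AT THE PINNED MEMBERS ONLY — no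
Prop. 5 ∕ 6 ∕ 7, Thm 8, Lemma 1 or Thm 2 line is read; Theorem 4's three Prop-5-type γ′ sockets are SERVED from the letters by dag-n05-w4's member-uniform
thresholds `exists_uniform_threshold_sp5{base,,u}_src_γ'`, exactly as in D9b.

WHAT THIS FILE PROVES (kernel bookkeeping by name; 0 `def`, 0 `sorry`):
* §1 ★ `leafLettersAT_of_lettersB9Src_allTorusPinned` — any C⋆-algebra `𝔸`, `d ≥ 2`, `L ≥ 2`, any `β`, `len`: the four letters at the pinned members, the input
  record `inp`, constants `BG BR B₀'H B₂' cL c59 cB9 γ₈ γ' B₈ B₀β C₂` under D9b's OWN guards (`2 ≤ 5dL·B₀`, `B₀ ≤ B₈`, `hγB`, the sourced free-constant guard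
  `hfreeS`, `C₂ = 2²¹(d+1)²L²`, `0 ≤ B₀β`) give thresholds `c₁, cP`, the window at `B₁' := 5dL·B₈` (Theorem 4's printed constant) and the two bodies on the PINNED
  `zdGF3` family.  Inside: dag-n05-w2's `B8Thm4ZdGF3PMapGammaPrime.thm4Printed_zdGF3HP_mapJ_γ'` at `ι :=` the pinned inclusion (`Φ := Site → 𝔸`, `Adm :=`
  Theorem 8's source premiss, `LanF := LanF146`, zero source — D9b's choices verbatim); dag-n05-d's `B8Prop3PrintedZdGF3PGamma.prop3Printed_zdGF3P_map_γ`; g0's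
  pinned `Iff`s (`zdGF3HP ∕ zdGF3P = zdGF3` there); dag-n16-c's `exists_window_print`.
* §2 ★ `h5_of_lettersB9Src_allTorusPinned` (`𝔸 = M_N(ℂ)`, `d = 4`): 37ᴴ's `h5 F` ∕ `stub_h5 β F` body VERBATIM at `L` (read `L := F.L`);
  `h5MS_of_lettersB9Src_allTorusPinned` — the R-β″ length-letter edition.
RELATION TO THE TREE.  dag-n16-c F47 `n16_of_socketsAllTorusPinned` reads n05-a's FIVE sockets `SockP5base ∕ SockP5 ∕ SockH59 ∕ SockP5uE ∕ SockB9P3` at the pinned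
members at `β = 1`; here the Prop-5 base ∕ step ∕ uniqueness sockets are SERVED from [4]'s letters (dag-n05-w4), the frame is the γ′-sourced one of the current
D-chain, and `β` is free (R-β ∕ R-β″).  g2's `h5_of_t4P_p3P` ∕ `h5_of_printedP_pinned` are the Thm-4 ∕ Prop-3-level faces one level up.

HONEST FRAMING.  Assembly BY NAME over landed γ′ faces; no estimate proved anew; the four letters are HYPOTHESES — [Balaban1985BackgroundPropagators] Thm 3.3-type
statements at the no-holes members (all `k ≥ 1`); inhabited in the tree at truncation `m = 0` only (dag-n06-b), `m ≥ 1` = the N06 lineage's OPEN content (g0 evidence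
#8 §2) — LOCATED, no joint-satisfiability claim; nothing of [Balaban1985RegularSpaces] asserted; **N16 ∕ N05 ∕ N06 NOT discharged**; count-neutral (typed 28∕28 ·
discharged 5∕27 UNMOVED); one finite four-torus at fixed ε — NOT ℝ⁴ ∕ infinite volume ∕ OS ∕ mass gap ∕ Clay (R4 closes the conditional finite-𝕋⁴ rung
`BalabanLadder.UV` only).  No `sorry`, no `def`, no `instance`, no `notation`.
-/

set_option autoImplicit false

open scoped BigOperators Matrix Matrix.Norms.L2Operator
open NormedSpace

noncomputable section

namespace Summit.QuantumFields.YangMills.BalabanUVNodes.N16H5OfLettersB9SrcAllTorusPinned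

open Literature.MathematicalPhysics.QuantumFieldTheory.Balaban1983to89
open Literature.MathematicalPhysics.QuantumFieldTheory.Balaban1983to89.B8LeafModelZd (ZdIdx)
open Literature.MathematicalPhysics.QuantumFieldTheory.Balaban1983to89.B8LeafModelZd3 (zdGF3 SockB9P3)
open Literature.MathematicalPhysics.QuantumFieldTheory.Balaban1983to89.B8LeafModelZd3P (zdGF3P zdGF3HP zdGF3HP_toGFData)
open Literature.MathematicalPhysics.QuantumFieldTheory.Balaban1983to89.B8TowerBondsPrinted (towerBondsP)
open Literature.MathematicalPhysics.QuantumFieldTheory.Balaban1983to89.B8SockLettersRD (SockLettersRD)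
open Literature.MathematicalPhysics.QuantumFieldTheory.Balaban1983to89.B8Lemma1NonAbelian (mulCfg)
open Literature.MathematicalPhysics.QuantumFieldTheory.Balaban1983to89.B8Thm4ZdGF3PMapGammaPrime (thm4Printed_zdGF3HP_mapJ_γ')
open Literature.MathematicalPhysics.QuantumFieldTheory.Balaban1983to89.B8Prop3PrintedZdGF3PGamma (prop3Printed_zdGF3P_map_γ)
open Literature.MathematicalPhysics.QuantumFieldTheory.Balaban1983to89.B8SockSP5UniformThresholdsSrcGammaPrime (exists_uniform_threshold_sp5_src_γ' exists_uniform_threshold_sp5base_src_γ' exists_uniform_threshold_sp5u_src_γ')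
open Literature.MathematicalPhysics.QuantumFieldTheory.Balaban1983to89.B8LanF146 (LanF146 lanF146_zero_iff)
open Literature.MathematicalPhysics.QuantumFieldTheory.Balaban1983to89.B8Eq138LandauZd (covLap QT InR138 inR138_zero)
open Literature.MathematicalPhysics.QuantumFieldTheory.Balaban1983to89.B8IdxB8LawsB (IdxB8LawsB)
open MatrixLog B7Prop1Explicit B7Prop2Explicit B7Prop1Local B7Eq92Concrete
open B7Prop3Flat (c3) open B8Ineq130 (tlo thi) open B8Ineq132 (InAk covDerivFwd) open B7Eq78Linearization (zdBlocking QprimeIter)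
open B8Eq119TwistedAxial (bgT Restr129 InAx) open B8Eq140Level (SideTouches) open B8Eq1117Concrete (XSpace) open B8Prop5ContractionKLevel (Bd2)
open B8LambdaSpaceKLevel (wt) open B8Eq184Proof (gaugeExp cfgExp) open B8Eq146AExpansion (iEta) open B7Prop4GeneralLevels (linCovIter)
open B8Eq155JBound (Jcur wsup) open B8ScaledSupNorm (bondNorm msup Bdd msup_le bdd_of_forall)
open Summit.QuantumFields.YangMills.BalabanUVNodes.N16PinnedPCarrierBridge (thm4Body_zdGF3P_pinned_iff prop3Body_zdGF3P_pinned_iff)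
open Summit.QuantumFields.YangMills.BalabanUVNodes.N16OfSocketsAllTorusPinned (idxB8LawsB_allTorusPinned)
open Summit.QuantumFields.YangMills.BalabanUVNodes.N16.OfLeaf (exists_window_print)

-- `Site` alone could resolve to the torus sites of `Setup.lean`; re-export the `ℤ^d` sites of `B7Prop1Explicit`.
export B7Prop1Explicit (Site)

/-! ## §1 ★ Stage-free, any C⋆-algebra: the `h5`-shaped existential at `(𝔸, d, L)` from the four letters at the pinned members -/

section StageFree

variable {d : ℕ} {𝔸 : Type} [CStarAlgebra 𝔸] [Nontrivial 𝔸] {L : ℕ}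

/-- ★ **N16's AT LEAF LETTERS FROM [Balaban1985BackgroundPropagators]'s FOUR LETTERS AT THE PINNED ALL-TORUS MEMBERS** (any C⋆-algebra `𝔸`, `d ≥ 2`, `L ≥ 2`, any
`β`, `len`; the engine of §2).  HYPOTHESES, all at the pinned members `{i : ZdIdx d L // Ω ≡ univ ∧ Λs m j = {j = m} ∧ Λb m j = {j = m} ∧ η = (L⁻¹)^k}` ONLY (node N05's
D9b binders with the law-member prefix replaced by the pinned index; every pinned member IS a law member): `SLet` (`SockLettersRD L BG BR B₀'H B₂' cL`, [4]'s existence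
letters in Prop. 5's frame) ∕ `SLetUB` (the guarded uniqueness letters) ∕ `SB9P` (the sourceless b9 socket `SockB9P3` of Prop. 3's frame, threshold `cB9`) ∕ `SH59src`
([4] Thm 3.3 WITH SOURCE in (1.146)'s frame, γ′ letter `γ₈`, threshold `c59`); the input record `inp`, Theorem 8's free constant `B₈`, D9b's guards (`2 ≤ 5dL·B₀`,
`B₀ ≤ B₈`, `hγB`, the sourced free-constant guard `hfreeS`), `C₂ = 2²¹(d+1)²L²`, `0 ≤ B₀(β₀)`.  CONCLUSION: thresholds `c₁, cP`, a window letter `c₁' > 0` with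
dag-n16-c's eleven-line window at `(d, L, B₁' := 5dL·B₈, C₂)` (`B₁'` = Theorem 4's printed constant; `0 < B₁'`, `5dL·B₀ ≤ B₁'` DERIVED and displayed), and node N05's
two conjuncts `B8.Thm4Body c₁ B₁'` ∕ `B8.Prop3Body cP d L C₂ inp B₀(β₀)` on the PINNED `zdGF3 𝔸 L β len` family (g2's `leafLettersAT` shape).  PROOF BY NAME: dag-n05-w4's
three member-uniform providers serve Theorem 4's Prop-5-type γ′ sockets from the letters; dag-n05-w2's `thm4Printed_zdGF3HP_mapJ_γ'` and dag-n05-d's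
`prop3Printed_zdGF3P_map_γ` at `ι :=` the pinned inclusion; g0's pinned `Iff`s; `exists_window_print`.  Nothing of Bałaban is proved: the four letters at truncations
`m ≥ 1` are the N06 lineage's open content. [cite: Balaban1985RegularSpaces, Thm 4 p.88, Prop. 3 p.87, (1.61) p.86, Prop. 5 (1.106)–(1.109) p.94, Thm 8 (1.146) p.101, p.77 («Ω_j = T_η»); Balaban1985BackgroundPropagators, Thm 3.1 p.397, Thm 3.3 p.398] [folklore] -/
theorem leafLettersAT_of_lettersB9Src_allTorusPinned (hd : 2 ≤ d) (hL : 2 ≤ L) (β : ℝ) (len : Site d → ℝ)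
    (inp : B8.B9Inputs) {B₀β C₂ : ℝ} (hB₀β : 0 ≤ B₀β) (hC₂eq : C₂ = 2097152 * ((d : ℝ) + 1) ^ 2 * (L : ℝ) ^ 2)
    {cB9 B₀'H B₂' BG BR cL c59 γ₈ γ' B₈ : ℝ}
    (hcB9 : 0 < cB9) (hB₀'H : 0 < B₀'H) (hB₂' : 0 ≤ B₂') (hBG : 0 ≤ BG) (hBR : 0 ≤ BR) (hcL : 0 < cL) (hc59 : 0 < c59) (hγ₈ : 1 ≤ γ₈) (hγ' : 0 ≤ γ')
    (hB : 2 ≤ 5 * (d : ℝ) * L * inp.B₀) (hB₀8 : inp.B₀ ≤ B₈)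
    (hγB : 5 * (d : ℝ) * L * inp.B₀ + 2 * (γ' * inp.B₀) ≤ 5 * (d : ℝ) * L * B₈)
    (hfreeS : 3 * (2 * (d : ℝ) * (L : ℝ) ^ 2) * BG * BR * (B₈ + γ₈) ≤ inp.B₀' * B₈)
    -- [4]'s letters AT THE PINNED ALL-TORUS MEMBERS ONLY: existence side (laws on print's domains) and uniqueness side
    (SLet : ∀ i : {i : ZdIdx d L // (∀ j, i.Ω j = Set.univ) ∧ (∀ m j, i.Λs m j = {_y | j = m}) ∧ (∀ m j, i.Λb m j = {_c | j = m}) ∧ i.η = ((L : ℝ)⁻¹) ^ i.k},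
      SockLettersRD (𝔸 := 𝔸) L BG BR B₀'H B₂' cL i.1.η i.1.k i.1.Ω i.1.Λs)
    (SLetUB : ∀ i : {i : ZdIdx d L // (∀ j, i.Ω j = Set.univ) ∧ (∀ m j, i.Λs m j = {_y | j = m}) ∧ (∀ m j, i.Λb m j = {_c | j = m}) ∧ i.η = ((L : ℝ)⁻¹) ^ i.k},
      ∀ α₀ : ℝ, 0 < α₀ → α₀ ≤ cL → ∀ U₀ : Site d → Fin d → 𝔸ˣ, (∀ x κ, U₀ x κ ∈ unitaryUnits 𝔸) →
      InAk L i.1.k i.1.η α₀ i.1.Ω U₀ →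
      ∃ (g Δ : (Site d → 𝔸) →ₗ[ℂ] (Site d → 𝔸)) (q : (Site d → 𝔸) →ₗ[ℂ] (ℕ → Site d → 𝔸))
        (qs : (ℕ → Site d → 𝔸) →ₗ[ℂ] (Site d → 𝔸)) (Aw c : (ℕ → Site d → 𝔸) →ₗ[ℂ] (ℕ → Site d → 𝔸))
        (H' : XSpace d i.1.k 𝔸 →ₗ[ℂ] (Site d → 𝔸)),
        (∀ x : Site d → 𝔸, (∃ C : ℝ, ∀ y, ‖x y‖ ≤ C) → g (Δ x + qs (Aw (q x))) = x) ∧ (∀ φ, qs (c (q (g (g (qs φ))))) = qs φ) ∧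
        (∀ (f : Site d → 𝔸), ∀ x ∈ i.1.Ω 0, Δ f x = covLap i.1.η U₀ ((i.1.Ω 0).indicator f) x) ∧
        (∀ (μ : ℕ → Site d → 𝔸), ∀ x ∈ i.1.Ω 0, qs μ x = QT L i.1.k (i.1.Λs i.1.k) U₀ μ x) ∧
        (∀ (f : Site d → 𝔸) (n : ℕ), n ≤ i.1.k → ∀ y ∈ i.1.Λs i.1.k n, q f n y = QprimeIter (zdBlocking d L) (bgT L U₀) n f y) ∧
        (∀ (f : Site d → 𝔸) (n : ℕ) (y : Site d), ¬ (n ≤ i.1.k ∧ y ∈ i.1.Λs i.1.k n) → q f n y = 0) ∧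
        (∀ (X : XSpace d i.1.k 𝔸) (x : Site d), ‖H' X x‖ ≤ B₀'H * ‖X‖) ∧
        (∀ n, n ≤ i.1.k → ∀ (X : XSpace d i.1.k 𝔸), ∀ p ∈ {b : Site d × Fin d | SideTouches (i.1.Ω n) b.1 b.2},
          wt L i.1.η n * ‖covDerivFwd i.1.η U₀ p.2 (H' X) p.1‖ ≤ B₀'H * ‖X‖) ∧
        (∀ X : XSpace d i.1.k 𝔸, Bd2 L i.1.η i.1.k i.1.Ω (covLap i.1.η U₀ (H' X)) (B₂' * ‖X‖)) ∧
        (∀ (Y : XSpace d i.1.k 𝔸) (n : ℕ) (hn : n ≤ i.1.k) (y : Site d), y ∈ i.1.Λs i.1.k n →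
          QprimeIter (zdBlocking d L) (bgT L U₀) n (H' Y) y = Y (⟨n, Nat.lt_succ_of_le hn⟩, y)) ∧
        (∀ (f : Site d → 𝔸) (r : ℝ), 0 ≤ r → Bd2 L i.1.η i.1.k i.1.Ω f r →
          (∀ x, ‖g f x‖ ≤ BG * r) ∧ ∀ n, n ≤ i.1.k → ∀ p ∈ {b : Site d × Fin d | SideTouches (i.1.Ω n) b.1 b.2},
            wt L i.1.η n * ‖covDerivFwd i.1.η U₀ p.2 (g f) p.1‖ ≤ BG * r) ∧
        (∀ (f : Site d → 𝔸) (r : ℝ), 0 ≤ r → Bd2 L i.1.η i.1.k i.1.Ω f r → Bd2 L i.1.η i.1.k i.1.Ω (f - g (qs (c (q (g f))))) (BR * r)))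
    -- the SOURCELESS b9 socket of Proposition 3's frame over PRINT's class, at the pinned members only ([4] Thm 3.3; threshold `cB9`) — for Prop. 3 AS PRINTED
    (SB9P : ∀ i : {i : ZdIdx d L // (∀ j, i.Ω j = Set.univ) ∧ (∀ m j, i.Λs m j = {_y | j = m}) ∧ (∀ m j, i.Λb m j = {_c | j = m}) ∧ i.η = ((L : ℝ)⁻¹) ^ i.k},
      SockB9P3 (𝔸 := 𝔸) L inp.B₀ B₀β cB9 β len i.1.η i.1.k i.1.Ω i.1.Λs (fun m j => towerBondsP L i.1.Ω (i.1.Λs m) j))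
    -- [Balaban1985BackgroundPropagators] Thm 3.3 WITH SOURCE in Theorem 4's frame at (1.146), γ′ letter, threshold `c59`, at the pinned members ONLY — HYPOTHESIS
    (SH59src : ∀ i : {i : ZdIdx d L // (∀ j, i.Ω j = Set.univ) ∧ (∀ m j, i.Λs m j = {_y | j = m}) ∧ (∀ m j, i.Λb m j = {_c | j = m}) ∧ i.η = ((L : ℝ)⁻¹) ^ i.k},
      ∀ α₀ α₁ : ℝ, 0 < α₀ → 0 < α₁ → α₀ + α₁ ≤ c59 →
      ∀ U₀ U' : Site d → Fin d → 𝔸ˣ, (∀ x κ, U₀ x κ ∈ unitaryUnits 𝔸) → (∀ x κ, U' x κ ∈ unitaryUnits 𝔸) →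
      ∀ φ : Site d → 𝔸, ((InR138 L i.1.k i.1.η (i.1.Ω 0) (i.1.Λs i.1.k) U₀ φ ∧ (∀ x, IsSelfAdjoint (φ x)) ∧ (∀ x, x ∉ i.1.Ω 0 → φ x = 0) ∧
          Bdd L i.1.k i.1.η (-(2 : ℝ)) (fun j (x : Site d) => x ∈ i.1.Ω j) φ) ∧
        msup L i.1.k i.1.η (-(2 : ℝ)) (fun j (x : Site d) => x ∈ i.1.Ω j) φ < γ₈ * (α₀ + α₁)) →
      InAk L i.1.k i.1.η α₀ i.1.Ω U₀ → InAk L i.1.k i.1.η α₀ i.1.Ω (mulCfg U' U₀) → (∀ m, m ≤ i.1.k → InAx L m (i.1.Λs m) U₀ (mulCfg U' U₀)) →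
      (∀ j, j ≤ i.1.k → ∀ (z : Site d) (μ : Fin d),
        ((∀ x, InBox (tlo L z j) (thi L z j) x → x ∈ i.1.Ω j) ∨ (∀ x, InBox (tlo L (z + e μ) j) (thi L (z + e μ) j) x → x ∈ i.1.Ω j)) →
        ‖(avgIter L (mulCfg U' U₀) j z μ : 𝔸) - (avgIter L U₀ j z μ : 𝔸)‖ ≤ α₁) →
      (∀ b ∈ {b : Site d × Fin d | SideTouches (i.1.Ω 0) b.1 b.2}, ‖((U' b.1 b.2 : 𝔸ˣ) : 𝔸) - 1‖ ≤ α₁) →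
      (∀ m, 1 ≤ m → m ≤ i.1.k → ∀ (u : Site d → 𝔸ˣ) (W : Site d → Fin d → 𝔸ˣ) (A' : Site d → Fin d → 𝔸),
        (∀ x, u x ∈ unitaryUnits 𝔸) → mgauge U₀ u W = U' → Restr129 L m (i.1.Λs m) U₀ u → LanF146 L i.1.k i.1.η (i.1.Ω 0) i.1.Λs U₀ φ m W →
        (∀ y τ, IsSelfAdjoint (A' y τ)) →
        (∀ j, j ≤ m → ∀ y τ, SideTouches (i.1.Ω j) y τ →
        W y τ = cfgExp i.1.η A' y τ ∧ ‖A' y τ‖ ≤ (2 * (L * (5 * (d : ℝ) * L * B₈ * (α₀ + α₁))) + 8 * (8 * inp.B₀' * (5 * (d : ℝ) * L * B₈) * (α₀ + α₁))) * ((L : ℝ) ^ j * i.1.η)⁻¹) →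
        (∀ y τ, (∀ j, j ≤ m → ¬ SideTouches (i.1.Ω j) y τ) → A' y τ = 0) →
        msup L m i.1.η (-(1 : ℝ)) (fun j (b : Site d × Fin d) => SideTouches (i.1.Ω j) b.1 b.2) (fun b => A' b.1 b.2)
        ≤ inp.B₀ * (bondNorm L m i.1.η (-(3 : ℝ)) i.1.Ω (fun x μ => Jcur i.1.η U₀ A' μ x)
        + wsup 1 (fun p : {p : ℕ × (Site d × Fin d) // p.1 ≤ m ∧ p.2 ∈ towerBondsP L i.1.Ω (i.1.Λs m) p.1} =>
        linCovIter L U₀ (iEta i.1.η A') p.1.1 p.1.2.1 p.1.2.2)) + γ' * inp.B₀ * (α₀ + α₁) ∧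
        msup L m i.1.η (-(2 : ℝ)) (fun j (t : Fin d × Fin d × Site d) => SideTouches (i.1.Ω j) t.2.2 t.2.1)
        (fun t => covDerivFwd i.1.η U₀ t.1 (fun z => A' z t.2.1) t.2.2)
        ≤ inp.B₀ * (bondNorm L m i.1.η (-(3 : ℝ)) i.1.Ω (fun x μ => Jcur i.1.η U₀ A' μ x)
        + wsup 1 (fun p : {p : ℕ × (Site d × Fin d) // p.1 ≤ m ∧ p.2 ∈ towerBondsP L i.1.Ω (i.1.Λs m) p.1} =>
        linCovIter L U₀ (iEta i.1.η A') p.1.1 p.1.2.1 p.1.2.2)) + γ' * inp.B₀ * (α₀ + α₁))) :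
    ∃ c₁ c₁' cP : ℝ, 0 < 5 * (d : ℝ) * L * B₈ ∧ 5 * (d : ℝ) * L * inp.B₀ ≤ 5 * (d : ℝ) * L * B₈ ∧ 0 < c₁' ∧
      (∀ α₀ α₁ : ℝ, 0 < α₀ → 0 < α₁ → α₀ + α₁ ≤ c₁' →
        α₀ + α₁ ≤ c₁ ∧ C0 d * (2 * α₀) ≤ 1 / 3 ∧ 4 * α₀ ≤ c2' d L ∧ 16 * (5 * (d : ℝ) * L * B₈ * (α₀ + α₁)) ≤ 1 ∧
        Real.exp (4 * (800 * ((d : ℝ) + 1) ^ 2 * ((d : ℝ) + 4)) * α₀) * (1 + 8 * (131072 * ((d : ℝ) + 1) ^ 2) * (5 * (d : ℝ) * L * B₈ * (α₀ + α₁))) ≤ 2 ∧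
        2 * (5 * (d : ℝ) * L * B₈ * (α₀ + α₁)) ≤ c3 d L ∧ (d : ℝ) * L * α₁ ≤ 1 / 8 ∧ α₀ ≤ cP ∧ α₁ ≤ cP ∧ 5 * (d : ℝ) * L * B₈ * (α₀ + α₁) ≤ cP ∧
        2 * (5 * (d : ℝ) * L * B₈ * (α₀ + α₁)) ^ 2 + 20 * d * α₀ * (5 * (d : ℝ) * L * B₈ * (α₀ + α₁)) +
          2 * C₂ * (5 * (d : ℝ) * L * B₈ * (α₀ + α₁)) ^ 2 ≤ α₀ + α₁) ∧
      B8.Thm4Body c₁ (5 * (d : ℝ) * L * B₈) (fun i : {i : ZdIdx d L // (∀ j, i.Ω j = Set.univ) ∧ (∀ m j, i.Λs m j = {_y | j = m}) ∧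
        (∀ m j, i.Λb m j = {_c | j = m}) ∧ i.η = ((L : ℝ)⁻¹) ^ i.k} => (zdGF3 𝔸 L β len i.1).toGFData) ∧
      B8.Prop3Body cP d (L : ℝ) C₂ inp B₀β (fun i : {i : ZdIdx d L // (∀ j, i.Ω j = Set.univ) ∧ (∀ m j, i.Λs m j = {_y | j = m}) ∧
        (∀ m j, i.Λb m j = {_c | j = m}) ∧ i.η = ((L : ℝ)⁻¹) ^ i.k} => (zdGF3 𝔸 L β len i.1).toGFData2) := by
  have hL1 : 1 ≤ L := le_trans (by norm_num) hL
  have hB₀ : 0 < inp.B₀ := inp.B₀_pos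
  have hB₈ : 0 < B₈ := lt_of_lt_of_le hB₀ hB₀8
  have h5 : 0 ≤ 5 * (d : ℝ) * L := by positivity
  have hB8' : 2 ≤ 5 * (d : ℝ) * L * B₈ := hB.trans (mul_le_mul_of_nonneg_left hB₀8 h5)
  have hγ₈0 : 0 ≤ γ₈ := zero_le_one.trans hγ₈
  have hγ₈pos : 0 < γ₈ := lt_of_lt_of_le one_pos hγ₈
  have hγB2 : 2 * (γ' * inp.B₀) ≤ 5 * (d : ℝ) * L * B₈ :=
    le_trans (le_add_of_nonneg_left (mul_nonneg h5 hB₀.le)) hγB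
  -- PROPOSITION 5 ∃∕! WITH SOURCE in the γ′ letters: the three sourced sockets below member-UNIFORM thresholds (dag-n05-w4), as in D9b
  obtain ⟨cP5, hcP5, H5⟩ := exists_uniform_threshold_sp5_src_γ' (𝔸 := 𝔸) (γ := γ₈) hd hL hB8' hfreeS hcL hB₀ inp.B₀'_pos hB₀'H hB₂' hBG
    hBR hγ₈0 hγ' hB₀8 hγB2 hc59
  obtain ⟨cPb, hcPb, Hb⟩ := exists_uniform_threshold_sp5base_src_γ' (𝔸 := 𝔸) (γ := γ₈) hd hL hfreeS hcL inp.B₀'_pos hB₀'H hB₂' hBG hBR hγ₈0 hB₈ hB8'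
  obtain ⟨cu, cPu, hcu, hcPu, Hu⟩ := exists_uniform_threshold_sp5u_src_γ' (𝔸 := 𝔸) (γ := γ₈) hd hL hB8' hcL hB₀ inp.B₀'_pos hB₀'H hB₂' hBG hBR
    hγ₈0 hγ' hB₀8 hγB2 hc59
  have hcP : 0 < min c59 (min cPb (min cP5 cPu)) := lt_min hc59 (lt_min hcPb (lt_min hcP5 hcPu))
  have hP59 : min c59 (min cPb (min cP5 cPu)) ≤ c59 := min_le_left _ _
  have hPb : min c59 (min cPb (min cP5 cPu)) ≤ cPb := (min_le_right _ _).trans (min_le_left _ _)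
  have hP5 : min c59 (min cPb (min cP5 cPu)) ≤ cP5 := (min_le_right _ _).trans ((min_le_right _ _).trans (min_le_left _ _))
  have hPu : min c59 (min cPb (min cP5 cPu)) ≤ cPu := (min_le_right _ _).trans ((min_le_right _ _).trans (min_le_right _ _))
  obtain ⟨cP, hcP', hP⟩ := prop3Printed_zdGF3P_map_γ (𝔸 := 𝔸) hd hL inp hB₀β (le_of_eq hC₂eq.symm) hcB9 β len
    (fun i : {i : ZdIdx d L // (∀ j, i.Ω j = Set.univ) ∧ (∀ m j, i.Λs m j = {_y | j = m}) ∧ (∀ m j, i.Λb m j = {_c | j = m}) ∧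
      i.η = ((L : ℝ)⁻¹) ^ i.k} => i.1) (fun i => SB9P i)
  -- THEOREM 4 on the HP-carrier along the pinned inclusion (`Φ := Site → 𝔸`, `Adm :=` Thm 8's source premiss, `LanF := LanF146`, zero source — as D9b)
  obtain ⟨c₁, hc₁, hT⟩ := thm4Printed_zdGF3HP_mapJ_γ' (𝔸 := 𝔸) (β := β) (len := len) hd hL hB₀ inp.B₀'_pos hcu hcP hγ' hB₈ hB₀8 hB8' hγB
    (fun i : {i : ZdIdx d L // (∀ j, i.Ω j = Set.univ) ∧ (∀ m j, i.Λs m j = {_y | j = m}) ∧ (∀ m j, i.Λb m j = {_c | j = m}) ∧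
      i.η = ((L : ℝ)⁻¹) ^ i.k} => i.1)
    (fun i (f : Site d → 𝔸) (U₀ : Site d → Fin d → 𝔸ˣ) (a0 b0 : ℝ) =>
      (InR138 L i.1.k i.1.η (i.1.Ω 0) (i.1.Λs i.1.k) U₀ f ∧ (∀ x, IsSelfAdjoint (f x)) ∧ (∀ x, x ∉ i.1.Ω 0 → f x = 0) ∧
          Bdd L i.1.k i.1.η (-(2 : ℝ)) (fun jj (x : Site d) => x ∈ i.1.Ω jj) f) ∧
        msup L i.1.k i.1.η (-(2 : ℝ)) (fun jj (x : Site d) => x ∈ i.1.Ω jj) f < γ₈ * (a0 + b0))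
    (fun i (U₀ : Site d → Fin d → 𝔸ˣ) (f : Site d → 𝔸) (m : ℕ) (W : Site d → Fin d → 𝔸ˣ) => LanF146 L i.1.k i.1.η (i.1.Ω 0) i.1.Λs U₀ f m W)
    (fun i α₀ α₁ hα₀ hα₁ hs => Hb i.1.η i.1.k i.1.Ω i.1.Λs (fun m jj => towerBondsP L i.1.Ω (i.1.Λs m) jj) i.1.hη i.1.hk i.1.hΩ
      (idxB8LawsB_allTorusPinned hL1 i).toIdxB8Laws.tower_all (SLet i) α₀ α₁ hα₀ hα₁ (hs.trans hPb))
    (fun i α₀ α₁ hα₀ hα₁ hs => H5 i.1.η i.1.k i.1.Ω i.1.Λs (fun m jj => towerBondsP L i.1.Ω (i.1.Λs m) jj) i.1.hη i.1.hΩ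
      (B8TowerBondsPrinted.ZdIdx.towerBondsP_laws i.1).1 (B8TowerBondsPrinted.ZdIdx.towerBondsP_laws i.1).2
      (idxB8LawsB_allTorusPinned hL1 i).toIdxB8Laws.tower_all (idxB8LawsB_allTorusPinned hL1 i).trunc_lt
      (idxB8LawsB_allTorusPinned hL1 i).trunc_top (SLet i) (SH59src i) α₀ α₁ hα₀ hα₁ (hs.trans hP5))
    (fun i α₀ α₁ hα₀ hα₁ hs => SH59src i α₀ α₁ hα₀ hα₁ (hs.trans hP59))
    (fun i α₀ α₁ hα₀ hα₁ hs => Hu i.1.η i.1.k i.1.Ω i.1.Λs (fun m jj => towerBondsP L i.1.Ω (i.1.Λs m) jj) i.1.hη i.1.hk i.1.hΩ (i.2.1 0)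
      (B8TowerBondsPrinted.ZdIdx.towerBondsP_laws i.1).1 (B8TowerBondsPrinted.ZdIdx.towerBondsP_laws i.1).2 i.1.htower
      (SLetUB i) (SH59src i) α₀ α₁ hα₀ hα₁ (hs.trans hPu))
    (0 : Site d → 𝔸)
    (fun i α₀ α₁ hα₀ hα₁ U₀ _ =>
      ⟨⟨inR138_zero i.1.η L U₀ i.1.k (i.1.Ω 0) (i.1.Λs i.1.k), fun _ => IsSelfAdjoint.zero 𝔸, fun _ _ => rfl,
        bdd_of_forall (c := 0) fun _ _ _ _ => by simp⟩,
       lt_of_le_of_lt (msup_le le_rfl fun _ _ _ _ => by simp) (mul_pos hγ₈pos (add_pos hα₀ hα₁))⟩)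
    (fun i U₀ W => lanF146_zero_iff L i.1.k i.1.η (i.1.Ω 0) i.1.Λs U₀ i.1.k W)
    (fun i => (idxB8LawsB_allTorusPinned hL1 i).toIdxB8Laws.tower_all)
  have hB₁' : 0 < 5 * (d : ℝ) * L * B₈ := lt_of_lt_of_le (by norm_num) hB8'
  have hBB : 5 * (d : ℝ) * L * inp.B₀ ≤ 5 * (d : ℝ) * L * B₈ := mul_le_mul_of_nonneg_left hB₀8 h5
  obtain ⟨c₁', hc₁', hwin⟩ := exists_window_print (d := d) (L := L) hd hL C₂ hc₁ hcP' hB₁'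
  refine ⟨c₁, c₁', cP, hB₁', hBB, hc₁', hwin, ?_, ?_⟩
  · -- Theorem 4's body: `zdGF3HP` and `zdGF3P` share `toGFData` (`rfl`), and at a pinned member the P-carrier IS `zdGF3` (g0)
    -- (`B8.Thm4Body … (fun i => (zdGF3HP …).toGFData)` and `… (zdGF3P …).toGFData` are the same term up to `rfl`, n05-w1's `zdGF3HP_toGFData`)
    exact (thm4Body_zdGF3P_pinned_iff (𝔸 := 𝔸) (β := β) (len := len) c₁ (5 * (d : ℝ) * L * B₈)).1 hT
  · exact (prop3Body_zdGF3P_pinned_iff (𝔸 := 𝔸) (β := β) (len := len) cP C₂ inp B₀β).1 hP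

end StageFree

/-! ## §2 ★ At N16's objects (`d = 4`, `𝔸 = M_N(ℂ)`): module 37ᴴ's `h5 F` ∕ `stub_h5 β F` body VERBATIM from the four letters at the pinned members -/

section Matrices

variable {N : ℕ} [NeZero N]

/-- ★ **37ᴴ's PER-FAMILY HYPOTHESIS `h5` ∕ `N16DischargeTest.stub_h5 β F` FROM [Balaban1985BackgroundPropagators]'s FOUR LETTERS AT THE PINNED ALL-TORUS MEMBERS**
(`d = 4`, colour algebra `M_N(ℂ)` with the `L²`-operator-norm C⋆-structure assembled in the statement, any `L ≥ 2` — read `L := F.L` —, any exponent `β` and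
length letter `len`): the letters `SLet` ∕ `SLetUB` ∕ `SB9P` ∕ `SH59src` (in this order, as `→` premises) at the pinned members ONLY, the input record `inp`,
Theorem 8's free constant `B₈` and the guards of node N05's knit of record D9b, together with N16's two length-letter lines, give the `h5` body (the conclusion
of g2's `h5_of_t4P_p3P` ∕ `h5_of_printedP_pinned`, 37ᴴ's hypothesis text): §1 at `𝔸 := M_N(ℂ)`, `d := 4`, witnesses `len`, `B₁' := 5·4·L·B₈`, `C₂`, `B₀β`,
`inp`.  Nothing of Bałaban is proved: the four letters at truncations `m ≥ 1` are the N06 lineage's open content.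
[cite: Balaban1985RegularSpaces, Thm 4 p.88, Prop. 3 p.87, (1.61) p.86, Prop. 5 p.94, Thm 8 (1.146) p.101, p.77 («Ω_j = T_η»); Balaban1985BackgroundPropagators, Thm 3.1 p.397, Thm 3.3 p.398] [folklore] -/
theorem h5_of_lettersB9Src_allTorusPinned {L : ℕ} (hL : 2 ≤ L) (β : ℝ) {len : Site 4 → ℝ}
    (hlen : ∀ v : Site 4, 0 < len v → 1 ≤ len v) (hlen1 : ∀ μ : Fin 4, len (e μ) = 1)
    (inp : B8.B9Inputs) {B₀β C₂ : ℝ} (hB₀β : 0 ≤ B₀β) (hC₂eq : C₂ = 2097152 * (((4 : ℕ) : ℝ) + 1) ^ 2 * (L : ℝ) ^ 2)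
    {cB9 B₀'H B₂' BG BR cL c59 γ₈ γ' B₈ : ℝ}
    (hcB9 : 0 < cB9) (hB₀'H : 0 < B₀'H) (hB₂' : 0 ≤ B₂') (hBG : 0 ≤ BG) (hBR : 0 ≤ BR) (hcL : 0 < cL) (hc59 : 0 < c59) (hγ₈ : 1 ≤ γ₈) (hγ' : 0 ≤ γ')
    (hB : 2 ≤ 5 * ((4 : ℕ) : ℝ) * L * inp.B₀) (hB₀8 : inp.B₀ ≤ B₈)
    (hγB : 5 * ((4 : ℕ) : ℝ) * L * inp.B₀ + 2 * (γ' * inp.B₀) ≤ 5 * ((4 : ℕ) : ℝ) * L * B₈)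
    (hfreeS : 3 * (2 * ((4 : ℕ) : ℝ) * (L : ℝ) ^ 2) * BG * BR * (B₈ + γ₈) ≤ inp.B₀' * B₈) :
    letI : CStarAlgebra (Matrix (Fin N) (Fin N) ℂ) := {}
    (∀ i : {i : ZdIdx 4 L // (∀ j, i.Ω j = Set.univ) ∧ (∀ m j, i.Λs m j = {_y | j = m}) ∧ (∀ m j, i.Λb m j = {_c | j = m}) ∧ i.η = ((L : ℝ)⁻¹) ^ i.k},
      SockLettersRD (𝔸 := Matrix (Fin N) (Fin N) ℂ) L BG BR B₀'H B₂' cL i.1.η i.1.k i.1.Ω i.1.Λs) →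
    (∀ i : {i : ZdIdx 4 L // (∀ j, i.Ω j = Set.univ) ∧ (∀ m j, i.Λs m j = {_y | j = m}) ∧ (∀ m j, i.Λb m j = {_c | j = m}) ∧ i.η = ((L : ℝ)⁻¹) ^ i.k},
      ∀ α₀ : ℝ, 0 < α₀ → α₀ ≤ cL → ∀ U₀ : Site 4 → Fin 4 → (Matrix (Fin N) (Fin N) ℂ)ˣ, (∀ x κ, U₀ x κ ∈ unitaryUnits (Matrix (Fin N) (Fin N) ℂ)) →
      InAk L i.1.k i.1.η α₀ i.1.Ω U₀ →
      ∃ (g Δ : (Site 4 → Matrix (Fin N) (Fin N) ℂ) →ₗ[ℂ] (Site 4 → Matrix (Fin N) (Fin N) ℂ)) (q : (Site 4 → Matrix (Fin N) (Fin N) ℂ) →ₗ[ℂ] (ℕ → Site 4 → Matrix (Fin N) (Fin N) ℂ))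
        (qs : (ℕ → Site 4 → Matrix (Fin N) (Fin N) ℂ) →ₗ[ℂ] (Site 4 → Matrix (Fin N) (Fin N) ℂ)) (Aw c : (ℕ → Site 4 → Matrix (Fin N) (Fin N) ℂ) →ₗ[ℂ] (ℕ → Site 4 → Matrix (Fin N) (Fin N) ℂ))
        (H' : XSpace 4 i.1.k (Matrix (Fin N) (Fin N) ℂ) →ₗ[ℂ] (Site 4 → Matrix (Fin N) (Fin N) ℂ)),
        (∀ x : Site 4 → Matrix (Fin N) (Fin N) ℂ, (∃ C : ℝ, ∀ y, ‖x y‖ ≤ C) → g (Δ x + qs (Aw (q x))) = x) ∧ (∀ φ, qs (c (q (g (g (qs φ))))) = qs φ) ∧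
        (∀ (f : Site 4 → Matrix (Fin N) (Fin N) ℂ), ∀ x ∈ i.1.Ω 0, Δ f x = covLap i.1.η U₀ ((i.1.Ω 0).indicator f) x) ∧
        (∀ (μ : ℕ → Site 4 → Matrix (Fin N) (Fin N) ℂ), ∀ x ∈ i.1.Ω 0, qs μ x = QT L i.1.k (i.1.Λs i.1.k) U₀ μ x) ∧
        (∀ (f : Site 4 → Matrix (Fin N) (Fin N) ℂ) (n : ℕ), n ≤ i.1.k → ∀ y ∈ i.1.Λs i.1.k n, q f n y = QprimeIter (zdBlocking 4 L) (bgT L U₀) n f y) ∧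
        (∀ (f : Site 4 → Matrix (Fin N) (Fin N) ℂ) (n : ℕ) (y : Site 4), ¬ (n ≤ i.1.k ∧ y ∈ i.1.Λs i.1.k n) → q f n y = 0) ∧
        (∀ (X : XSpace 4 i.1.k (Matrix (Fin N) (Fin N) ℂ)) (x : Site 4), ‖H' X x‖ ≤ B₀'H * ‖X‖) ∧
        (∀ n, n ≤ i.1.k → ∀ (X : XSpace 4 i.1.k (Matrix (Fin N) (Fin N) ℂ)), ∀ p ∈ {b : Site 4 × Fin 4 | SideTouches (i.1.Ω n) b.1 b.2},
          wt L i.1.η n * ‖covDerivFwd i.1.η U₀ p.2 (H' X) p.1‖ ≤ B₀'H * ‖X‖) ∧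
        (∀ X : XSpace 4 i.1.k (Matrix (Fin N) (Fin N) ℂ), Bd2 L i.1.η i.1.k i.1.Ω (covLap i.1.η U₀ (H' X)) (B₂' * ‖X‖)) ∧
        (∀ (Y : XSpace 4 i.1.k (Matrix (Fin N) (Fin N) ℂ)) (n : ℕ) (hn : n ≤ i.1.k) (y : Site 4), y ∈ i.1.Λs i.1.k n →
          QprimeIter (zdBlocking 4 L) (bgT L U₀) n (H' Y) y = Y (⟨n, Nat.lt_succ_of_le hn⟩, y)) ∧
        (∀ (f : Site 4 → Matrix (Fin N) (Fin N) ℂ) (r : ℝ), 0 ≤ r → Bd2 L i.1.η i.1.k i.1.Ω f r →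
          (∀ x, ‖g f x‖ ≤ BG * r) ∧ ∀ n, n ≤ i.1.k → ∀ p ∈ {b : Site 4 × Fin 4 | SideTouches (i.1.Ω n) b.1 b.2},
            wt L i.1.η n * ‖covDerivFwd i.1.η U₀ p.2 (g f) p.1‖ ≤ BG * r) ∧
        (∀ (f : Site 4 → Matrix (Fin N) (Fin N) ℂ) (r : ℝ), 0 ≤ r → Bd2 L i.1.η i.1.k i.1.Ω f r → Bd2 L i.1.η i.1.k i.1.Ω (f - g (qs (c (q (g f))))) (BR * r))) →
    (∀ i : {i : ZdIdx 4 L // (∀ j, i.Ω j = Set.univ) ∧ (∀ m j, i.Λs m j = {_y | j = m}) ∧ (∀ m j, i.Λb m j = {_c | j = m}) ∧ i.η = ((L : ℝ)⁻¹) ^ i.k},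
      SockB9P3 (𝔸 := Matrix (Fin N) (Fin N) ℂ) L inp.B₀ B₀β cB9 β len i.1.η i.1.k i.1.Ω i.1.Λs (fun m j => towerBondsP L i.1.Ω (i.1.Λs m) j)) →
    (∀ i : {i : ZdIdx 4 L // (∀ j, i.Ω j = Set.univ) ∧ (∀ m j, i.Λs m j = {_y | j = m}) ∧ (∀ m j, i.Λb m j = {_c | j = m}) ∧ i.η = ((L : ℝ)⁻¹) ^ i.k},
      ∀ α₀ α₁ : ℝ, 0 < α₀ → 0 < α₁ → α₀ + α₁ ≤ c59 →
      ∀ U₀ U' : Site 4 → Fin 4 → (Matrix (Fin N) (Fin N) ℂ)ˣ, (∀ x κ, U₀ x κ ∈ unitaryUnits (Matrix (Fin N) (Fin N) ℂ)) → (∀ x κ, U' x κ ∈ unitaryUnits (Matrix (Fin N) (Fin N) ℂ)) →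
      ∀ φ : Site 4 → Matrix (Fin N) (Fin N) ℂ, ((InR138 L i.1.k i.1.η (i.1.Ω 0) (i.1.Λs i.1.k) U₀ φ ∧ (∀ x, IsSelfAdjoint (φ x)) ∧ (∀ x, x ∉ i.1.Ω 0 → φ x = 0) ∧
          Bdd L i.1.k i.1.η (-(2 : ℝ)) (fun j (x : Site 4) => x ∈ i.1.Ω j) φ) ∧
        msup L i.1.k i.1.η (-(2 : ℝ)) (fun j (x : Site 4) => x ∈ i.1.Ω j) φ < γ₈ * (α₀ + α₁)) →
      InAk L i.1.k i.1.η α₀ i.1.Ω U₀ → InAk L i.1.k i.1.η α₀ i.1.Ω (mulCfg U' U₀) → (∀ m, m ≤ i.1.k → InAx L m (i.1.Λs m) U₀ (mulCfg U' U₀)) →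
      (∀ j, j ≤ i.1.k → ∀ (z : Site 4) (μ : Fin 4),
        ((∀ x, InBox (tlo L z j) (thi L z j) x → x ∈ i.1.Ω j) ∨ (∀ x, InBox (tlo L (z + e μ) j) (thi L (z + e μ) j) x → x ∈ i.1.Ω j)) →
        ‖(avgIter L (mulCfg U' U₀) j z μ : Matrix (Fin N) (Fin N) ℂ) - (avgIter L U₀ j z μ : Matrix (Fin N) (Fin N) ℂ)‖ ≤ α₁) →
      (∀ b ∈ {b : Site 4 × Fin 4 | SideTouches (i.1.Ω 0) b.1 b.2}, ‖((U' b.1 b.2 : (Matrix (Fin N) (Fin N) ℂ)ˣ) : Matrix (Fin N) (Fin N) ℂ) - 1‖ ≤ α₁) →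
      (∀ m, 1 ≤ m → m ≤ i.1.k → ∀ (u : Site 4 → (Matrix (Fin N) (Fin N) ℂ)ˣ) (W : Site 4 → Fin 4 → (Matrix (Fin N) (Fin N) ℂ)ˣ) (A' : Site 4 → Fin 4 → Matrix (Fin N) (Fin N) ℂ),
        (∀ x, u x ∈ unitaryUnits (Matrix (Fin N) (Fin N) ℂ)) → mgauge U₀ u W = U' → Restr129 L m (i.1.Λs m) U₀ u → LanF146 L i.1.k i.1.η (i.1.Ω 0) i.1.Λs U₀ φ m W →
        (∀ y τ, IsSelfAdjoint (A' y τ)) →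
        (∀ j, j ≤ m → ∀ y τ, SideTouches (i.1.Ω j) y τ →
        W y τ = cfgExp i.1.η A' y τ ∧ ‖A' y τ‖ ≤ (2 * (L * (5 * ((4 : ℕ) : ℝ) * L * B₈ * (α₀ + α₁))) + 8 * (8 * inp.B₀' * (5 * ((4 : ℕ) : ℝ) * L * B₈) * (α₀ + α₁))) * ((L : ℝ) ^ j * i.1.η)⁻¹) →
        (∀ y τ, (∀ j, j ≤ m → ¬ SideTouches (i.1.Ω j) y τ) → A' y τ = 0) →
        msup L m i.1.η (-(1 : ℝ)) (fun j (b : Site 4 × Fin 4) => SideTouches (i.1.Ω j) b.1 b.2) (fun b => A' b.1 b.2)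
        ≤ inp.B₀ * (bondNorm L m i.1.η (-(3 : ℝ)) i.1.Ω (fun x μ => Jcur i.1.η U₀ A' μ x)
        + wsup 1 (fun p : {p : ℕ × (Site 4 × Fin 4) // p.1 ≤ m ∧ p.2 ∈ towerBondsP L i.1.Ω (i.1.Λs m) p.1} =>
        linCovIter L U₀ (iEta i.1.η A') p.1.1 p.1.2.1 p.1.2.2)) + γ' * inp.B₀ * (α₀ + α₁) ∧
        msup L m i.1.η (-(2 : ℝ)) (fun j (t : Fin 4 × Fin 4 × Site 4) => SideTouches (i.1.Ω j) t.2.2 t.2.1)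
        (fun t => covDerivFwd i.1.η U₀ t.1 (fun z => A' z t.2.1) t.2.2)
        ≤ inp.B₀ * (bondNorm L m i.1.η (-(3 : ℝ)) i.1.Ω (fun x μ => Jcur i.1.η U₀ A' μ x)
        + wsup 1 (fun p : {p : ℕ × (Site 4 × Fin 4) // p.1 ≤ m ∧ p.2 ∈ towerBondsP L i.1.Ω (i.1.Λs m) p.1} =>
        linCovIter L U₀ (iEta i.1.η A') p.1.1 p.1.2.1 p.1.2.2)) + γ' * inp.B₀ * (α₀ + α₁))) →
    ∃ (len : Site 4 → ℝ) (c₁ c₁' B₁' cP C₂ B₀β : ℝ) (inp : B8.B9Inputs),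
      (∀ v : Site 4, 0 < len v → 1 ≤ len v) ∧ (∀ μ : Fin 4, len (e μ) = 1) ∧ 0 < B₁' ∧ 5 * ((4 : ℕ) : ℝ) * L * inp.B₀ ≤ B₁' ∧ 0 < c₁' ∧
      (∀ α₀ α₁ : ℝ, 0 < α₀ → 0 < α₁ → α₀ + α₁ ≤ c₁' →
        α₀ + α₁ ≤ c₁ ∧ C0 4 * (2 * α₀) ≤ 1 / 3 ∧ 4 * α₀ ≤ c2' 4 L ∧ 16 * (B₁' * (α₀ + α₁)) ≤ 1 ∧
        Real.exp (4 * (800 * (((4 : ℕ) : ℝ) + 1) ^ 2 * (((4 : ℕ) : ℝ) + 4)) * α₀) * (1 + 8 * (131072 * (((4 : ℕ) : ℝ) + 1) ^ 2) * (B₁' * (α₀ + α₁))) ≤ 2 ∧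
        2 * (B₁' * (α₀ + α₁)) ≤ c3 4 L ∧ ((4 : ℕ) : ℝ) * L * α₁ ≤ 1 / 8 ∧ α₀ ≤ cP ∧ α₁ ≤ cP ∧ B₁' * (α₀ + α₁) ≤ cP ∧
        2 * (B₁' * (α₀ + α₁)) ^ 2 + 20 * ((4 : ℕ) : ℝ) * α₀ * (B₁' * (α₀ + α₁)) + 2 * C₂ * (B₁' * (α₀ + α₁)) ^ 2 ≤ α₀ + α₁) ∧
      B8.Thm4Body c₁ B₁' (fun i : {i : ZdIdx 4 L // (∀ j, i.Ω j = Set.univ) ∧ (∀ m j, i.Λs m j = {_y | j = m}) ∧ (∀ m j, i.Λb m j = {_c | j = m}) ∧ i.η = ((L : ℝ)⁻¹) ^ i.k} => (zdGF3 (Matrix (Fin N) (Fin N) ℂ) L β len i.1).toGFData) ∧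
      B8.Prop3Body cP 4 (L : ℝ) C₂ inp B₀β (fun i : {i : ZdIdx 4 L // (∀ j, i.Ω j = Set.univ) ∧ (∀ m j, i.Λs m j = {_y | j = m}) ∧ (∀ m j, i.Λb m j = {_c | j = m}) ∧ i.η = ((L : ℝ)⁻¹) ^ i.k} => (zdGF3 (Matrix (Fin N) (Fin N) ℂ) L β len i.1).toGFData2) := by
  letI : CStarAlgebra (Matrix (Fin N) (Fin N) ℂ) := {}
  intro SLet SLetUB SB9P SH59src
  obtain ⟨c₁, c₁', cP, hB₁', hBB, hc₁', hwin, hT, hP⟩ := leafLettersAT_of_lettersB9Src_allTorusPinned (𝔸 := Matrix (Fin N) (Fin N) ℂ) (d := 4) (by norm_num) hL β len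
    inp hB₀β hC₂eq hcB9 hB₀'H hB₂' hBG hBR hcL hc59 hγ₈ hγ' hB hB₀8 hγB hfreeS SLet SLetUB SB9P SH59src
  exact ⟨len, c₁, c₁', 5 * ((4 : ℕ) : ℝ) * L * B₈, cP, C₂, B₀β, inp, hlen, hlen1, hB₁', hBB, hc₁', hwin, hT, hP⟩

/-- ★ **THE SAME IN THE R-β″ (MULTI-SCALE LENGTH LETTER) SHAPE** — 37ᴴ's `h5` of `exists_letters_s_N16HolderMS_readingOfRecord₁₃CoPHOn_of_edges_allTorus`, whose second
length-letter line reads `∀ μ j, len (j • e_μ) = j` instead of `len e_μ = 1`; the letters, constants and guards as in `h5_of_lettersB9Src_allTorusPinned`.  Nothing of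
Bałaban is proved. [cite: Balaban1985RegularSpaces, Thm 4 p.88, Prop. 3 p.87, (1.61) p.86, Thm 8 (1.146) p.101, p.77; Balaban1985BackgroundPropagators, Thm 3.3 p.398] [folklore] -/
theorem h5MS_of_lettersB9Src_allTorusPinned {L : ℕ} (hL : 2 ≤ L) (β : ℝ) {len : Site 4 → ℝ}
    (hlen : ∀ v : Site 4, 0 < len v → 1 ≤ len v) (hlenj : ∀ (μ : Fin 4) (j : ℕ), len (j • e μ) = j)
    (inp : B8.B9Inputs) {B₀β C₂ : ℝ} (hB₀β : 0 ≤ B₀β) (hC₂eq : C₂ = 2097152 * (((4 : ℕ) : ℝ) + 1) ^ 2 * (L : ℝ) ^ 2)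
    {cB9 B₀'H B₂' BG BR cL c59 γ₈ γ' B₈ : ℝ}
    (hcB9 : 0 < cB9) (hB₀'H : 0 < B₀'H) (hB₂' : 0 ≤ B₂') (hBG : 0 ≤ BG) (hBR : 0 ≤ BR) (hcL : 0 < cL) (hc59 : 0 < c59) (hγ₈ : 1 ≤ γ₈) (hγ' : 0 ≤ γ')
    (hB : 2 ≤ 5 * ((4 : ℕ) : ℝ) * L * inp.B₀) (hB₀8 : inp.B₀ ≤ B₈)
    (hγB : 5 * ((4 : ℕ) : ℝ) * L * inp.B₀ + 2 * (γ' * inp.B₀) ≤ 5 * ((4 : ℕ) : ℝ) * L * B₈)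
    (hfreeS : 3 * (2 * ((4 : ℕ) : ℝ) * (L : ℝ) ^ 2) * BG * BR * (B₈ + γ₈) ≤ inp.B₀' * B₈) :
    letI : CStarAlgebra (Matrix (Fin N) (Fin N) ℂ) := {}
    (∀ i : {i : ZdIdx 4 L // (∀ j, i.Ω j = Set.univ) ∧ (∀ m j, i.Λs m j = {_y | j = m}) ∧ (∀ m j, i.Λb m j = {_c | j = m}) ∧ i.η = ((L : ℝ)⁻¹) ^ i.k},
      SockLettersRD (𝔸 := Matrix (Fin N) (Fin N) ℂ) L BG BR B₀'H B₂' cL i.1.η i.1.k i.1.Ω i.1.Λs) →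
    (∀ i : {i : ZdIdx 4 L // (∀ j, i.Ω j = Set.univ) ∧ (∀ m j, i.Λs m j = {_y | j = m}) ∧ (∀ m j, i.Λb m j = {_c | j = m}) ∧ i.η = ((L : ℝ)⁻¹) ^ i.k},
      ∀ α₀ : ℝ, 0 < α₀ → α₀ ≤ cL → ∀ U₀ : Site 4 → Fin 4 → (Matrix (Fin N) (Fin N) ℂ)ˣ, (∀ x κ, U₀ x κ ∈ unitaryUnits (Matrix (Fin N) (Fin N) ℂ)) →
      InAk L i.1.k i.1.η α₀ i.1.Ω U₀ →
      ∃ (g Δ : (Site 4 → Matrix (Fin N) (Fin N) ℂ) →ₗ[ℂ] (Site 4 → Matrix (Fin N) (Fin N) ℂ)) (q : (Site 4 → Matrix (Fin N) (Fin N) ℂ) →ₗ[ℂ] (ℕ → Site 4 → Matrix (Fin N) (Fin N) ℂ))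
        (qs : (ℕ → Site 4 → Matrix (Fin N) (Fin N) ℂ) →ₗ[ℂ] (Site 4 → Matrix (Fin N) (Fin N) ℂ)) (Aw c : (ℕ → Site 4 → Matrix (Fin N) (Fin N) ℂ) →ₗ[ℂ] (ℕ → Site 4 → Matrix (Fin N) (Fin N) ℂ))
        (H' : XSpace 4 i.1.k (Matrix (Fin N) (Fin N) ℂ) →ₗ[ℂ] (Site 4 → Matrix (Fin N) (Fin N) ℂ)),
        (∀ x : Site 4 → Matrix (Fin N) (Fin N) ℂ, (∃ C : ℝ, ∀ y, ‖x y‖ ≤ C) → g (Δ x + qs (Aw (q x))) = x) ∧ (∀ φ, qs (c (q (g (g (qs φ))))) = qs φ) ∧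
        (∀ (f : Site 4 → Matrix (Fin N) (Fin N) ℂ), ∀ x ∈ i.1.Ω 0, Δ f x = covLap i.1.η U₀ ((i.1.Ω 0).indicator f) x) ∧
        (∀ (μ : ℕ → Site 4 → Matrix (Fin N) (Fin N) ℂ), ∀ x ∈ i.1.Ω 0, qs μ x = QT L i.1.k (i.1.Λs i.1.k) U₀ μ x) ∧
        (∀ (f : Site 4 → Matrix (Fin N) (Fin N) ℂ) (n : ℕ), n ≤ i.1.k → ∀ y ∈ i.1.Λs i.1.k n, q f n y = QprimeIter (zdBlocking 4 L) (bgT L U₀) n f y) ∧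
        (∀ (f : Site 4 → Matrix (Fin N) (Fin N) ℂ) (n : ℕ) (y : Site 4), ¬ (n ≤ i.1.k ∧ y ∈ i.1.Λs i.1.k n) → q f n y = 0) ∧
        (∀ (X : XSpace 4 i.1.k (Matrix (Fin N) (Fin N) ℂ)) (x : Site 4), ‖H' X x‖ ≤ B₀'H * ‖X‖) ∧
        (∀ n, n ≤ i.1.k → ∀ (X : XSpace 4 i.1.k (Matrix (Fin N) (Fin N) ℂ)), ∀ p ∈ {b : Site 4 × Fin 4 | SideTouches (i.1.Ω n) b.1 b.2},
          wt L i.1.η n * ‖covDerivFwd i.1.η U₀ p.2 (H' X) p.1‖ ≤ B₀'H * ‖X‖) ∧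
        (∀ X : XSpace 4 i.1.k (Matrix (Fin N) (Fin N) ℂ), Bd2 L i.1.η i.1.k i.1.Ω (covLap i.1.η U₀ (H' X)) (B₂' * ‖X‖)) ∧
        (∀ (Y : XSpace 4 i.1.k (Matrix (Fin N) (Fin N) ℂ)) (n : ℕ) (hn : n ≤ i.1.k) (y : Site 4), y ∈ i.1.Λs i.1.k n →
          QprimeIter (zdBlocking 4 L) (bgT L U₀) n (H' Y) y = Y (⟨n, Nat.lt_succ_of_le hn⟩, y)) ∧
        (∀ (f : Site 4 → Matrix (Fin N) (Fin N) ℂ) (r : ℝ), 0 ≤ r → Bd2 L i.1.η i.1.k i.1.Ω f r →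
          (∀ x, ‖g f x‖ ≤ BG * r) ∧ ∀ n, n ≤ i.1.k → ∀ p ∈ {b : Site 4 × Fin 4 | SideTouches (i.1.Ω n) b.1 b.2},
            wt L i.1.η n * ‖covDerivFwd i.1.η U₀ p.2 (g f) p.1‖ ≤ BG * r) ∧
        (∀ (f : Site 4 → Matrix (Fin N) (Fin N) ℂ) (r : ℝ), 0 ≤ r → Bd2 L i.1.η i.1.k i.1.Ω f r → Bd2 L i.1.η i.1.k i.1.Ω (f - g (qs (c (q (g f))))) (BR * r))) →
    (∀ i : {i : ZdIdx 4 L // (∀ j, i.Ω j = Set.univ) ∧ (∀ m j, i.Λs m j = {_y | j = m}) ∧ (∀ m j, i.Λb m j = {_c | j = m}) ∧ i.η = ((L : ℝ)⁻¹) ^ i.k},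
      SockB9P3 (𝔸 := Matrix (Fin N) (Fin N) ℂ) L inp.B₀ B₀β cB9 β len i.1.η i.1.k i.1.Ω i.1.Λs (fun m j => towerBondsP L i.1.Ω (i.1.Λs m) j)) →
    (∀ i : {i : ZdIdx 4 L // (∀ j, i.Ω j = Set.univ) ∧ (∀ m j, i.Λs m j = {_y | j = m}) ∧ (∀ m j, i.Λb m j = {_c | j = m}) ∧ i.η = ((L : ℝ)⁻¹) ^ i.k},
      ∀ α₀ α₁ : ℝ, 0 < α₀ → 0 < α₁ → α₀ + α₁ ≤ c59 →
      ∀ U₀ U' : Site 4 → Fin 4 → (Matrix (Fin N) (Fin N) ℂ)ˣ, (∀ x κ, U₀ x κ ∈ unitaryUnits (Matrix (Fin N) (Fin N) ℂ)) → (∀ x κ, U' x κ ∈ unitaryUnits (Matrix (Fin N) (Fin N) ℂ)) →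
      ∀ φ : Site 4 → Matrix (Fin N) (Fin N) ℂ, ((InR138 L i.1.k i.1.η (i.1.Ω 0) (i.1.Λs i.1.k) U₀ φ ∧ (∀ x, IsSelfAdjoint (φ x)) ∧ (∀ x, x ∉ i.1.Ω 0 → φ x = 0) ∧
          Bdd L i.1.k i.1.η (-(2 : ℝ)) (fun j (x : Site 4) => x ∈ i.1.Ω j) φ) ∧
        msup L i.1.k i.1.η (-(2 : ℝ)) (fun j (x : Site 4) => x ∈ i.1.Ω j) φ < γ₈ * (α₀ + α₁)) →
      InAk L i.1.k i.1.η α₀ i.1.Ω U₀ → InAk L i.1.k i.1.η α₀ i.1.Ω (mulCfg U' U₀) → (∀ m, m ≤ i.1.k → InAx L m (i.1.Λs m) U₀ (mulCfg U' U₀)) →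
      (∀ j, j ≤ i.1.k → ∀ (z : Site 4) (μ : Fin 4),
        ((∀ x, InBox (tlo L z j) (thi L z j) x → x ∈ i.1.Ω j) ∨ (∀ x, InBox (tlo L (z + e μ) j) (thi L (z + e μ) j) x → x ∈ i.1.Ω j)) →
        ‖(avgIter L (mulCfg U' U₀) j z μ : Matrix (Fin N) (Fin N) ℂ) - (avgIter L U₀ j z μ : Matrix (Fin N) (Fin N) ℂ)‖ ≤ α₁) →
      (∀ b ∈ {b : Site 4 × Fin 4 | SideTouches (i.1.Ω 0) b.1 b.2}, ‖((U' b.1 b.2 : (Matrix (Fin N) (Fin N) ℂ)ˣ) : Matrix (Fin N) (Fin N) ℂ) - 1‖ ≤ α₁) →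
      (∀ m, 1 ≤ m → m ≤ i.1.k → ∀ (u : Site 4 → (Matrix (Fin N) (Fin N) ℂ)ˣ) (W : Site 4 → Fin 4 → (Matrix (Fin N) (Fin N) ℂ)ˣ) (A' : Site 4 → Fin 4 → Matrix (Fin N) (Fin N) ℂ),
        (∀ x, u x ∈ unitaryUnits (Matrix (Fin N) (Fin N) ℂ)) → mgauge U₀ u W = U' → Restr129 L m (i.1.Λs m) U₀ u → LanF146 L i.1.k i.1.η (i.1.Ω 0) i.1.Λs U₀ φ m W →
        (∀ y τ, IsSelfAdjoint (A' y τ)) →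
        (∀ j, j ≤ m → ∀ y τ, SideTouches (i.1.Ω j) y τ →
        W y τ = cfgExp i.1.η A' y τ ∧ ‖A' y τ‖ ≤ (2 * (L * (5 * ((4 : ℕ) : ℝ) * L * B₈ * (α₀ + α₁))) + 8 * (8 * inp.B₀' * (5 * ((4 : ℕ) : ℝ) * L * B₈) * (α₀ + α₁))) * ((L : ℝ) ^ j * i.1.η)⁻¹) →
        (∀ y τ, (∀ j, j ≤ m → ¬ SideTouches (i.1.Ω j) y τ) → A' y τ = 0) →
        msup L m i.1.η (-(1 : ℝ)) (fun j (b : Site 4 × Fin 4) => SideTouches (i.1.Ω j) b.1 b.2) (fun b => A' b.1 b.2)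
        ≤ inp.B₀ * (bondNorm L m i.1.η (-(3 : ℝ)) i.1.Ω (fun x μ => Jcur i.1.η U₀ A' μ x)
        + wsup 1 (fun p : {p : ℕ × (Site 4 × Fin 4) // p.1 ≤ m ∧ p.2 ∈ towerBondsP L i.1.Ω (i.1.Λs m) p.1} =>
        linCovIter L U₀ (iEta i.1.η A') p.1.1 p.1.2.1 p.1.2.2)) + γ' * inp.B₀ * (α₀ + α₁) ∧
        msup L m i.1.η (-(2 : ℝ)) (fun j (t : Fin 4 × Fin 4 × Site 4) => SideTouches (i.1.Ω j) t.2.2 t.2.1)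
        (fun t => covDerivFwd i.1.η U₀ t.1 (fun z => A' z t.2.1) t.2.2)
        ≤ inp.B₀ * (bondNorm L m i.1.η (-(3 : ℝ)) i.1.Ω (fun x μ => Jcur i.1.η U₀ A' μ x)
        + wsup 1 (fun p : {p : ℕ × (Site 4 × Fin 4) // p.1 ≤ m ∧ p.2 ∈ towerBondsP L i.1.Ω (i.1.Λs m) p.1} =>
        linCovIter L U₀ (iEta i.1.η A') p.1.1 p.1.2.1 p.1.2.2)) + γ' * inp.B₀ * (α₀ + α₁))) →
    ∃ (len : Site 4 → ℝ) (c₁ c₁' B₁' cP C₂ B₀β : ℝ) (inp : B8.B9Inputs),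
      (∀ v : Site 4, 0 < len v → 1 ≤ len v) ∧ (∀ (μ : Fin 4) (j : ℕ), len (j • e μ) = j) ∧ 0 < B₁' ∧ 5 * ((4 : ℕ) : ℝ) * L * inp.B₀ ≤ B₁' ∧ 0 < c₁' ∧
      (∀ α₀ α₁ : ℝ, 0 < α₀ → 0 < α₁ → α₀ + α₁ ≤ c₁' →
        α₀ + α₁ ≤ c₁ ∧ C0 4 * (2 * α₀) ≤ 1 / 3 ∧ 4 * α₀ ≤ c2' 4 L ∧ 16 * (B₁' * (α₀ + α₁)) ≤ 1 ∧
        Real.exp (4 * (800 * (((4 : ℕ) : ℝ) + 1) ^ 2 * (((4 : ℕ) : ℝ) + 4)) * α₀) * (1 + 8 * (131072 * (((4 : ℕ) : ℝ) + 1) ^ 2) * (B₁' * (α₀ + α₁))) ≤ 2 ∧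
        2 * (B₁' * (α₀ + α₁)) ≤ c3 4 L ∧ ((4 : ℕ) : ℝ) * L * α₁ ≤ 1 / 8 ∧ α₀ ≤ cP ∧ α₁ ≤ cP ∧ B₁' * (α₀ + α₁) ≤ cP ∧
        2 * (B₁' * (α₀ + α₁)) ^ 2 + 20 * ((4 : ℕ) : ℝ) * α₀ * (B₁' * (α₀ + α₁)) + 2 * C₂ * (B₁' * (α₀ + α₁)) ^ 2 ≤ α₀ + α₁) ∧
      B8.Thm4Body c₁ B₁' (fun i : {i : ZdIdx 4 L // (∀ j, i.Ω j = Set.univ) ∧ (∀ m j, i.Λs m j = {_y | j = m}) ∧ (∀ m j, i.Λb m j = {_c | j = m}) ∧ i.η = ((L : ℝ)⁻¹) ^ i.k} => (zdGF3 (Matrix (Fin N) (Fin N) ℂ) L β len i.1).toGFData) ∧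
      B8.Prop3Body cP 4 (L : ℝ) C₂ inp B₀β (fun i : {i : ZdIdx 4 L // (∀ j, i.Ω j = Set.univ) ∧ (∀ m j, i.Λs m j = {_y | j = m}) ∧ (∀ m j, i.Λb m j = {_c | j = m}) ∧ i.η = ((L : ℝ)⁻¹) ^ i.k} => (zdGF3 (Matrix (Fin N) (Fin N) ℂ) L β len i.1).toGFData2) := by
  letI : CStarAlgebra (Matrix (Fin N) (Fin N) ℂ) := {}
  intro SLet SLetUB SB9P SH59src
  obtain ⟨c₁, c₁', cP, hB₁', hBB, hc₁', hwin, hT, hP⟩ := leafLettersAT_of_lettersB9Src_allTorusPinned (𝔸 := Matrix (Fin N) (Fin N) ℂ) (d := 4) (by norm_num) hL β len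
    inp hB₀β hC₂eq hcB9 hB₀'H hB₂' hBG hBR hcL hc59 hγ₈ hγ' hB hB₀8 hγB hfreeS SLet SLetUB SB9P SH59src
  exact ⟨len, c₁, c₁', 5 * ((4 : ℕ) : ℝ) * L * B₈, cP, C₂, B₀β, inp, hlen, hlenj, hB₁', hBB, hc₁', hwin, hT, hP⟩

end Matrices

end Summit.QuantumFields.YangMills.BalabanUVNodes.N16H5OfLettersB9SrcAllTorusPinned

end
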